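import Summits.NavierStokesRegularity.NavierStokesRegularity.Theses.LevelSetModeration

/-!
# Route LevelSetModeration — `HighSpeedPressureWork` from the linear split (transfer of line `linear_closure`)

Support file for item stmt-NavierStokesRegularity-18149 (crux `HighSpeedPressureWork`, rank 2). The
strategist's skeleton `Cruxes/HighSpeedPressureWork/Lines/linear_closure.lean` proves the crux BY NAME
from three stubs; this file lands the composition as the TRANSFER

  `LinearLevelSetLaw → UniformLevelSetClosure → BoundedPairingBookkeeping → HighSpeedPressureWork`,

with the three hypotheses spelled out verbatim (they are the children of the strategist's decomposition
of the crux by STRENGTH):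

* `LinearLevelSetLaw` (open, the load): for every `ν, T > 0` some `m < 10/3` and modulus `Λ(E₀,B₀)`
  give, on every admissible window `M ≥ 2B₀`, `c ∈ [M/2, M]`, the LINEAR level-set law
  `ν² D_c(T) ≤ Λ M^m V_c(T)` and `∫(|u(t)|−c)₊² ≤ 4 Λ M^m V_c(T)/ν` (`t < T`) — exactly the input the
  landed De Giorgi closure `levelSetClosure_proof` consumes (`levelSetEnergy_le_of_pairingBound`), and
  a consequence of the crux.
* `UniformLevelSetClosure` (provable now): the linear law on windows `M ≥ M₀` bounds a solution with
  `∫|u₀|² ≤ E₀`, `|u₀| ≤ M₀/2` by a constant depending only on `(ν, T, m, Λ, E₀, M₀)` (class-uniform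
  refactor of `levelSetClosure_proof`).
* `BoundedPairingBookkeeping` (true on paper): under a class-uniform a priori speed bound `G(E₀,B₀)`
  on the fibre `(ν, T)` the pairing obeys the crux's product bound without the `M`-factor.

The proof is logic: `(m, Λ)` from the law; `G(E₀,B₀)` from the closure with `M₀ := 2·max(B₀,0)+2`;
`F` from the bookkeeping; exponent `0 < 10/3` and `M^0 = 1`.
-/

noncomputable section

-- single-conjunct summit: `Summit.<Summit>.<Problem>` repeats the name by the D-0017 layout
set_option linter.dupNamespace false

namespace Summit.NavierStokesRegularity.NavierStokesRegularity.Theorems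

open MeasureTheory Set Filter Topology
open scoped ENNReal
open Literature.Analysis.FluidPDE
open Summit.NavierStokesRegularity.NavierStokesRegularity.Theses.LevelSetModeration

/-- **`HighSpeedPressureWork` from the linear split** (transfer of the strategist line
`linear_closure`): the linear level-set law (De Giorgi's exact input), the class-uniform De Giorgi
closure and the bounded pairing bookkeeping compose to the crux with exponent `0`; the three
hypotheses are the registered stubs `stub_linearLevelSetLaw`, `stub_uniformLevelSetClosure`,
`stub_boundedPairingBookkeeping` verbatim. [folklore] -/
theorem levelSetModeration_highSpeedPressureWork_of_linearSplit :
    (∀ (ν T : ℝ), 0 < ν → 0 < T → ∃ m : ℝ, m < 10 / 3 ∧ ∃ Λ : ℝ → ℝ → ℝ, ∀ (u : ℝ → EuclideanSpace ℝ (Fin 3) → EuclideanSpace ℝ (Fin 3)) (p : ℝ → EuclideanSpace ℝ (Fin 3) → ℝ), Literature.Analysis.FluidPDE.IsClassicalNSSolutionOn (Set.Ico 0 T) ν 0 u p → Literature.Analysis.FluidPDE.IsLerayHopfOn T ν 0 (u 0) u → Literature.Analysis.FluidPDE.HasRapidSpatialDecay (u 0) → ∀ (E₀ B₀ : ℝ),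 (∫ x, ‖u 0 x‖ ^ 2) ≤ E₀ → (∀ x, ‖u 0 x‖ ≤ B₀) → ∀ (M c : ℝ), 2 * B₀ ≤ M → M / 2 ≤ c → c ≤ M → 0 < c → ν ^ 2 * (∫⁻ τ in Set.Ioo 0 T, ∫⁻ x, Set.indicator {x | c < ‖u τ x‖} (fun x => ENNReal.ofReal (‖fderiv ℝ (fun y => ‖u τ y‖) x‖ ^ 2)) x).toReal ≤ Λ E₀ B₀ * M ^ m * (∫⁻ τ in Set.Ioo 0 T, volume {x | c < ‖u τ x‖}).toReal ∧ ∀ t ∈ Set.Ico 0 T, (∫ x, (max (‖u t x‖ - c) 0) ^ 2) ≤ 4 * (Λ E₀ B₀ * M ^ m * (∫⁻ τ in Set.Ioo 0 T, volume {x | c < ‖u τ x‖}).toReal) / ν) →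
    (∀ (ν T m Λ E₀ M₀ : ℝ), 0 < ν → 0 < T → m < 10 / 3 → 0 < M₀ → ∃ G : ℝ, ∀ (u : ℝ → EuclideanSpace ℝ (Fin 3) → EuclideanSpace ℝ (Fin 3)) (p : ℝ → EuclideanSpace ℝ (Fin 3) → ℝ), Literature.Analysis.FluidPDE.IsClassicalNSSolutionOn (Set.Ico 0 T) ν 0 u p → Literature.Analysis.FluidPDE.IsLerayHopfOn T ν 0 (u 0) u → Literature.Analysis.FluidPDE.HasRapidSpatialDecay (u 0) → (∫ x, ‖u 0 x‖ ^ 2) ≤ E₀ → (∀ x, ‖u 0 x‖ ≤ M₀ / 2) → (∀ (M c : ℝ), M₀ ≤ M → M / 2 ≤ c → c ≤ M → 0 < c → ν ^ 2 * (∫⁻ τ in Set.Ioo 0 T, ∫⁻ x, Set.indicator {x | c < ‖u τ x‖} (fun x => ENNReal.ofReal (‖fderiv ℝ (fun y => ‖u τ y‖) x‖ ^ 2)) x).toReal ≤ Λ * M ^ m * (∫⁻ τ in Set.Ioo 0 T, volume {x | c < ‖u τ x‖}).toReal ∧ ∀ t ∈ Set.Ico 0 T, (∫ x, (max (‖u t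 x‖ - c) 0) ^ 2) ≤ 4 * (Λ * M ^ m * (∫⁻ τ in Set.Ioo 0 T, volume {x | c < ‖u τ x‖}).toReal) / ν) → ∀ t ∈ Set.Ico 0 T, ∀ x, ‖u t x‖ ≤ G) →
    (∀ (ν T : ℝ), 0 < ν → 0 < T → ∀ G : ℝ → ℝ → ℝ, (∀ (u : ℝ → EuclideanSpace ℝ (Fin 3) → EuclideanSpace ℝ (Fin 3)) (p : ℝ → EuclideanSpace ℝ (Fin 3) → ℝ), Literature.Analysis.FluidPDE.IsClassicalNSSolutionOn (Set.Ico 0 T) ν 0 u p → Literature.Analysis.FluidPDE.IsLerayHopfOn T ν 0 (u 0) u → Literature.Analysis.FluidPDE.HasRapidSpatialDecay (u 0) → ∀ (E₀ B₀ : ℝ), (∫ x, ‖u 0 x‖ ^ 2) ≤ E₀ → (∀ x, ‖u 0 x‖ ≤ B₀) → ∀ t ∈ Set.Ico 0 T, ∀ x, ‖u t x‖ ≤ G E₀ B₀) → ∃ F : ℝ → ℝ → ℝ, ∀ (u : ℝ → EuclideanSpace ℝ (Fin 3) → EuclideanSpace ℝ (Fin 3)) (p : ℝ → EuclideanSpace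 ℝ (Fin 3) → ℝ), Literature.Analysis.FluidPDE.IsClassicalNSSolutionOn (Set.Ico 0 T) ν 0 u p → Literature.Analysis.FluidPDE.IsLerayHopfOn T ν 0 (u 0) u → Literature.Analysis.FluidPDE.HasRapidSpatialDecay (u 0) → ∀ (E₀ B₀ : ℝ), (∫ x, ‖u 0 x‖ ^ 2) ≤ E₀ → (∀ x, ‖u 0 x‖ ≤ B₀) → ∀ (M c t : ℝ), 2 * B₀ ≤ M → M / 2 ≤ c → c ≤ M → 0 < c → t ∈ Set.Ico 0 T → -(∫ τ in Set.Ioo 0 t, ∫ x, max (1 - c / ‖u τ x‖) 0 * (fderiv ℝ (Literature.Analysis.FluidPDE.normalisedPressure (u τ)) x (u τ x))) ≤ Real.sqrt (F E₀ B₀ * (∫⁻ τ in Set.Ioo 0 T, volume {x | c < ‖u τ x‖}).toReal) * Real.sqrt ((∫⁻ τ in Set.Ioo 0 T, ∫⁻ x, Set.indicator {x | c < ‖u τ x‖} (fun x => ENNReal.ofReal (‖fderiv ℝ (fun y => ‖u τ y‖) x‖ ^ 2)) x).toReal)) →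
    Summit.NavierStokesRegularity.NavierStokesRegularity.Theses.LevelSetModeration.HighSpeedPressureWork := by
  intro hLaw hClos hBook ν T hν hT
  obtain ⟨m, hm, Λ, hΛ⟩ := hLaw ν T hν hT
  -- class-uniform speed bound on every data fibre `(E₀, B₀)` (closure with `M₀ := 2·max(B₀,0)+2`)
  have hGex : ∀ E₀ B₀ : ℝ, ∃ G : ℝ,
      ∀ (u : ℝ → EuclideanSpace ℝ (Fin 3) → EuclideanSpace ℝ (Fin 3))
        (p : ℝ → EuclideanSpace ℝ (Fin 3) → ℝ),
        Literature.Analysis.FluidPDE.IsClassicalNSSolutionOn (Set.Ico 0 T) ν 0 u p →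
        Literature.Analysis.FluidPDE.IsLerayHopfOn T ν 0 (u 0) u →
        Literature.Analysis.FluidPDE.HasRapidSpatialDecay (u 0) →
        (∫ x, ‖u 0 x‖ ^ 2) ≤ E₀ → (∀ x, ‖u 0 x‖ ≤ B₀) →
        ∀ t ∈ Set.Ico 0 T, ∀ x, ‖u t x‖ ≤ G := by
    intro E₀ B₀
    have hB : B₀ ≤ max B₀ 0 := le_max_left _ _
    have hM₀ : 0 < 2 * max B₀ 0 + 2 := by positivity
    obtain ⟨G, hG⟩ := hClos ν T m (Λ E₀ B₀) E₀ (2 * max B₀ 0 + 2) hν hT hm hM₀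
    refine ⟨G, fun u p hcl hLH hdec hE hB₀ => hG u p hcl hLH hdec hE ?_ ?_⟩
    · intro x
      have hx := hB₀ x
      linarith
    · intro M c hM hMc hcM hc
      exact hΛ u p hcl hLH hdec E₀ B₀ hE hB₀ M c (by linarith) hMc hcM hc
  choose G hG using hGex
  -- the bookkeeping on the fibre, then exponent `0`
  obtain ⟨F, hF⟩ := hBook ν T hν hT G
    (fun u p hcl hLH hdec E₀ B₀ hE hB₀ => hG E₀ B₀ u p hcl hLH hdec hE hB₀)
  refine ⟨0, by norm_num, F, ?_⟩
  intro u p hcl hLH hdec E₀ B₀ hE hB₀ M c t hM hMc hcM hc ht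
  rw [Real.rpow_zero, mul_one]
  exact hF u p hcl hLH hdec E₀ B₀ hE hB₀ M c t hM hMc hcM hc ht

end Summit.NavierStokesRegularity.NavierStokesRegularity.Theorems

end
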